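import Summits.HodgeConjecture.HodgeConjecture.Theorems.Ring2HypothesesDescentMotivatedHodgeDomination
import Summits.HodgeConjecture.HodgeConjecture.Theorems.Ring2HypothesesDescentMotivatedCupProduct
import Literature.AlgebraicGeometry.HodgeTheory.MotivatedClassesRationalSpan
import HarnessLib

/-!
# Ring 2 hypotheses, descent face — ARAPURA'S CLAUSE `AC` UNDER WEAK MOTIVATION: «Hodge classes are motivated» descends
# along domination by MOTIVATED correspondences; Cor. 4.4 («weakly motivated by an Abelian variety») modulo c2

research route conditional on HC_CM; not a corollary; Q11.4-sentence-2 already refuted in dim ≥ 3.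
Cell `pub-hodge-ring2` (Hodge ladder STAGE 3), seat `ring2-b05` (binder row b05
`Ring2.Hypotheses.MotivatedImpliesAlgebraicAV`, `Ring2HypothesesDescent.lean` :177), gen 41, fourth file (companion of
`Ring2HypothesesDescentMotivatedHodgeDomination`, the STRONG-domination clause `AC`). `HC_CM`
(`Theses.RankFourFaces.CMAbelianHodge`) does not occur in this file; nothing here proves a case of the Hodge conjecture; no
binder of `BINDER-OWNERS.md` is discharged; row b05 stays OPEN and is not asserted; the named fact c2
`Andre1996_hodgeClasses_abelianVariety_motivated` (André 1996 Thm. 0.6.2) occurs only as the displayed hypothesis `hAM` of §3.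

Arapura 2006 §1: «Replacing `M_A(𝒱)` by `M_A(𝒱)^full` leads to the more flexible … notion of weak motivation. For
example, André has shown that any K3 surface is weakly motivated by an Abelian variety»; Lemma 1.1: «`Y` is (weakly)
motivated by `X` if and only if there exists a morphism `f : ⊕ [X]^{⊗n}(m) → [Y]` in `M_A(X)` (`M_A(X)^full`) inducing a
surjection on cohomology» — in `M_A(X)^full` the morphisms are ALL motivated correspondences (André's `C⁰_mot`); Lemma
4.2, last clause: «If `Y` is weakly motivated by `X` and `AC` holds for all powers of `X`, then it holds for all powers of
`Y`»; Cor. 4.4: «If `X` is weakly motivated by an Abelian variety, then `AC` holds for `X` and all its powers». The tree's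
`HodgeTheory.IsDominatedByPowers` renders STRONG motivation (algebraic correspondences); this file renders the cohomological
criterion of Lemma 1.1 for WEAK motivation INLINE (no definition): every `H²ᵖ(Y(ℂ); ℂ)` is the `ℂ`-span of the images of
the actions `[u]_* = corrAction complexOrientationFamily …` of MOTIVATED classes `u ∈ A_mot((Y ⊗ Xᵉ))_ℂ` on the cohomology
of the cartesian powers `Xᵉ`.

* §1 `span_rationalMotivatedCorrRanges_eq_top_of_motivated` — such a spanning family may be taken with `u` RATIONAL
  motivated generators (André Prop. 3.2.1 / 3.3 on the carriers: `A_mot_ℂ` is the span of its rational generators, the tree's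
  `motivatedClasses_le_span_isRationalClass`; `u ↦ [u]_* x` is linear).
* §2 **`hodgeClasses_motivated_of_motivatedDomination` — CLAUSE `AC` UNDER WEAK MOTIVATION**: if `H²ᵖ(Y(ℂ))` is spanned as
  above and every rational `(d,d)`-class on every power `Xᵉ` is motivated, then every rational `(p,p)`-class on `Y` is
  motivated — the Hodge-structure engine of the tree's HC-clause discharge (`CorCM.Stage4.exists_isRationalClass_isOfHodgeType_eq_sum_int`:
  a rational MOTIVATED `u` is a rational class of type `(cd, cd)` by André §2.5 c) (the tree's theorem
  `isOfHodgeType_of_mem_motivatedClasses`), so `[u]_*` is a rational Hodge-linear map with an integer Tate twist killing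
  the types it cannot shift), and `[u]_*` preserves motivated classes for MOTIVATED `u` (André Prop. 2.1 Corollaire «les
  correspondances motivées», gen 35's `corrClassAction_mem_motivatedClasses_of_motivated`).
* §3 **`hodgeClasses_motivated_of_motivatedDomination_abelianVariety` — COR. 4.4 MODULO c2**: a smooth projective `Y` whose
  even cohomology is spanned by the images of motivated correspondences from the powers of a complex abelian variety has all
  its Hodge classes MOTIVATED, granted André's Thm. 0.6.2 (displayed).

HONEST COLUMN. No definition, no NEW named fact, no sorry; c2 displayed, never asserted. The weak-motivation instances in
print (K3 surfaces, hyperkähler varieties of known deformation types — André 1996 §7, via Kuga–Satake) are NOT supplied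
here: the tree's `Hyperkaehler/HodgeClassesMotivated` records them as named facts of their own; this file is the inference
only. Relevance to row b05: on a variety weakly motivated by an abelian variety, «Hodge ⟹ motivated» costs c2 and «motivated
⟹ algebraic» IS row b05 (gen 40) — nothing of the row is claimed.

PRESEARCH: [corpus: `paper:arxiv-math_0501348` Arapura 2006 §1 (weak motivation, Lemma 1.1), §4 Lemma 4.2 (last clause),
Cor. 4.4, re-opened this session]; [corpus: `paper:doi-10-1007-bf02698643` André 1996 Prop. 2.1 Corollaire p. 15, §2.5 c)
p. 18, Prop. 3.2.1 / 3.3 pp. 20–21] — certification on the carriers, no novelty in print claimed.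

References (bib keys): Arapura2006 (§1 Lemma 1.1, §4 Lemma 4.2, Cor. 4.4), Andre1996Motifs (Prop. 2.1 Corollaire (p. 15),
§2.5 c) (p. 18), Prop. 3.2.1 (p. 20), Prop. 3.3 (p. 21), Thm. 0.6.2 (p. 9)), Voisin2025 (Prop. 2.11, Cor. 2.12),
VoisinHodgeI2002 (§7.3.2, Lemma 11.41), VoisinHodgeII2003 ((10.7)).
-/

noncomputable section

-- every declaration of this problem lives in `Summit.HodgeConjecture.HodgeConjecture.…` (summit = sub-problem)
set_option linter.dupNamespace false

open CategoryTheory AlgebraicGeometry MonoidalCategory CartesianMonoidalCategory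
open Literature.AlgebraicTopology.SingularHomology Literature.Geometry.Kaehler
open Literature.AlgebraicGeometry Literature.AlgebraicGeometry.Motives
  Literature.AlgebraicGeometry.HodgeTheory
open Summit.HodgeConjecture.CorCM.Stage4 (exists_isRationalClass_isOfHodgeType_eq_sum_int
  isRationalClass_corrAction_complex isOfHodgeType_corrAction_complex corrAction_eq_zero_of_hodgeType_lt)

namespace Summit.HodgeConjecture.HodgeConjecture.Theorems

variable {dX dY : ℕ} {X Y : SchemeOver ℂ}

/-! ## §1 A motivated spanning family may be taken rational -/

/-- **Domination by MOTIVATED correspondences may be witnessed by RATIONAL motivated classes.** If `H²ᵖ(Y(ℂ); ℂ)` is the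
`ℂ`-span of the images of the actions `[u]_*` (complex orientations) of motivated classes `u` on the products `Y ⊗ Xᵉ`,
then it is the `ℂ`-span of the images of the `[g]_*` with `g` a RATIONAL motivated generator: every `u ∈ A_mot_ℂ` is a
`ℂ`-combination of rational generators (André Prop. 3.2.1 with Prop. 3.3, the tree's
`motivatedClasses_le_span_isRationalClass`) and `u ↦ [u]_* x` is linear. [cite: Andre1996Motifs, Prop. 3.2.1 (p. 20) and Prop. 3.3 (p. 21)]
[cite: Arapura2006, §1 Lemma 1.1] -/
theorem span_rationalMotivatedCorrRanges_eq_top_of_motivated (hX : IsSmoothProjective dX X)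
    (hY : IsSmoothProjective dY Y) (p : ℕ)
    (hdom : Submodule.span ℂ
        {c : complexBetti Y (2 * p) |
          ∃ (e cd d : ℕ) (hab : 2 * d + 2 * cd = 2 * p + 2 * (e * dX))
            (u : complexBetti (Y ⊗ X.pow e) (2 * cd)),
            u ∈ motivatedClasses (dY + e * dX) (Y ⊗ X.pow e) cd ∧
              c ∈ LinearMap.range (corrAction complexOrientationFamily hY (hX.pow e) hab u)} = ⊤) :
    Submodule.span ℂ
        {c : complexBetti Y (2 * p) |
          ∃ (e cd d : ℕ) (hab : 2 * d + 2 * cd = 2 * p + 2 * (e * dX))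
            (g : complexBetti (Y ⊗ X.pow e) (2 * cd)),
            IsRationalClass g ∧ g ∈ motivatedClasses (dY + e * dX) (Y ⊗ X.pow e) cd ∧
              c ∈ LinearMap.range (corrAction complexOrientationFamily hY (hX.pow e) hab g)} = ⊤ := by
  refine eq_top_iff.2 (hdom.symm.le.trans (Submodule.span_le.2 ?_))
  rintro c ⟨e, cd, d, hab, u, hu, ⟨x, rfl⟩⟩
  have hYXe := IsSmoothProjective.tensor_holds hY (hX.pow e)
  -- `u ↦ [u]_* x` is linear and `u` is a `ℂ`-combination of rational motivated generators
  have hu' := motivatedClasses_le_span_isRationalClass hYXe cd hu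
  have hlin : corrAction complexOrientationFamily hY (hX.pow e) hab u x =
      ((corrAction complexOrientationFamily hY (hX.pow e) hab).flip x) u := by
    rw [LinearMap.flip_apply]
  rw [SetLike.mem_coe, hlin]
  have hmem : ((corrAction complexOrientationFamily hY (hX.pow e) hab).flip x) u ∈
      (Submodule.span ℂ {g : complexBetti (Y ⊗ X.pow e) (2 * cd) |
          IsRationalClass g ∧ IsMotivatedClass (dY + e * dX) (Y ⊗ X.pow e) cd g}).map
        ((corrAction complexOrientationFamily hY (hX.pow e) hab).flip x) :=
    Submodule.mem_map_of_mem hu'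
  rw [Submodule.map_span] at hmem
  refine Submodule.span_mono ?_ hmem
  rintro _ ⟨g, ⟨hg₁, hg₂⟩, rfl⟩
  exact ⟨e, cd, d, hab, g, hg₁, hg₂.mem_motivatedClasses, x, by rw [LinearMap.flip_apply]⟩

/-! ## §2 Clause `AC` under weak motivation -/

/-- **ARAPURA'S LEMMA 4.2, CLAUSE `AC`, UNDER WEAK MOTIVATION (real carriers).** Let `X`, `Y` be smooth projective of
dimensions `dX`, `dY`; suppose `H²ᵖ(Y(ℂ); ℂ)` is the `ℂ`-span of the images of the actions `[u]_*` of MOTIVATED classes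
`u ∈ A_mot((Y ⊗ Xᵉ))_ℂ` on the cohomology of the powers `Xᵉ` (Arapura's Lemma 1.1 criterion for `[Y] ∈ M_A(X)^full`), and
that on every power `Xᵉ` every rational class of type `(d,d)` is motivated (`AC(Xᵉ)`). Then every rational `(p,p)`-class `c`
on `Y` is motivated. Proof: by §1 finitely many RATIONAL motivated `gᵢ` carry `c`; a rational motivated class is of type
`(cdᵢ, cdᵢ)` (André §2.5 c), `isOfHodgeType_of_mem_motivatedClasses`), so `[gᵢ]_*` is a rational Hodge-linear map with Tate
twist `cdᵢ − eᵢ·dX` killing the types it cannot shift (`CorCM.Stage4.isRationalClass_corrAction_complex`,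
`isOfHodgeType_corrAction_complex`, `corrAction_eq_zero_of_hodgeType_lt`); semisimplicity of polarisable Hodge structures
writes `c = Σ [gᵢ]_* aᵢ` with `aᵢ` rational of type `(dᵢ, dᵢ)` (`exists_isRationalClass_isOfHodgeType_eq_sum_int`); the
`aᵢ` are motivated by hypothesis and `[gᵢ]_*` preserves motivated classes because `gᵢ` is MOTIVATED (André Prop. 2.1
Corollaire, gen 35's `corrClassAction_mem_motivatedClasses_of_motivated`). Neither hypothesis is asserted.
[cite: Arapura2006, §4 Lemma 4.2 and §1 Lemma 1.1] [cite: Andre1996Motifs, Prop. 2.1 Corollaire (p. 15) and §2.5 c) (p. 18)]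
[cite: Voisin2025, Prop. 2.11 and Cor. 2.12] -/
theorem hodgeClasses_motivated_of_motivatedDomination (hX : IsSmoothProjective dX X) (hY : IsSmoothProjective dY Y)
    (p : ℕ)
    (hdom : Submodule.span ℂ
        {c : complexBetti Y (2 * p) |
          ∃ (e cd d : ℕ) (hab : 2 * d + 2 * cd = 2 * p + 2 * (e * dX))
            (u : complexBetti (Y ⊗ X.pow e) (2 * cd)),
            u ∈ motivatedClasses (dY + e * dX) (Y ⊗ X.pow e) cd ∧
              c ∈ LinearMap.range (corrAction complexOrientationFamily hY (hX.pow e) hab u)} = ⊤)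
    (hAC : ∀ (e d : ℕ) (a : complexBetti (X.pow e) (2 * d)), IsRationalClass a →
      IsOfHodgeType (e * dX) (X.pow e) (2 * d) d d a → a ∈ motivatedClasses (e * dX) (X.pow e) d)
    {c : complexBetti Y (2 * p)} (hc : IsRationalClass c) (hpp : IsOfHodgeType dY Y (2 * p) p p c) :
    c ∈ motivatedClasses dY Y p := by
  classical
  -- degrees beyond `2 dim Y`: nothing to prove
  by_cases hp : 2 * dY < 2 * p
  · haveI := subsingleton_complexBetti hY hp
    rw [Subsingleton.elim c 0]
    exact Submodule.zero_mem _
  obtain ⟨k, hk⟩ : ∃ k, 2 * p + 2 * k = 2 * dY := ⟨dY - p, by omega⟩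
  -- a finite family of rational motivated correspondences carrying `c`
  have hc1 := (span_rationalMotivatedCorrRanges_eq_top_of_motivated hX hY p hdom).symm ▸ Submodule.mem_top (x := c)
  obtain ⟨T, hTS, hcT⟩ := Submodule.mem_span_finite_of_mem_span hc1
  have hdata : ∀ t : T, ∃ (e cd d : ℕ) (hab : 2 * d + 2 * cd = 2 * p + 2 * (e * dX))
      (g : complexBetti (Y ⊗ X.pow e) (2 * cd)),
      IsRationalClass g ∧ g ∈ motivatedClasses (dY + e * dX) (Y ⊗ X.pow e) cd ∧
        (t : complexBetti Y (2 * p)) ∈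
          LinearMap.range (corrAction complexOrientationFamily hY (hX.pow e) hab g) :=
    fun t ↦ hTS t.2
  choose e cd d hab g hgr hgm hgt using hdata
  -- the Hodge-structure engine for the family `[g t]_*`, twists `cd t − e t · dX`
  obtain ⟨a, ha, hsum⟩ := exists_isRationalClass_isOfHodgeType_eq_sum_int hY
    (ι := T) (m := fun t ↦ e t * dX) (d := d) (Y := fun t ↦ X.pow (e t)) (fun t ↦ hX.pow (e t)) p
    (fun t ↦ (cd t : ℤ) - (e t * dX : ℕ)) (fun t ↦ by have := hab t; push_cast; omega)
    (fun t ↦ corrAction complexOrientationFamily hY (hX.pow (e t)) (hab t) (g t))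
    (fun t y hy ↦ isRationalClass_corrAction_complex hY (hX.pow (e t)) (hab t) (hgr t) hy)
    (fun t p₀ q₀ y _ hy p₁ q₁ hp₁ hq₁ ↦ isOfHodgeType_corrAction_complex hY (hX.pow (e t)) (hab t)
      (isOfHodgeType_of_mem_motivatedClasses (IsSmoothProjective.tensor_holds hY (hX.pow (e t))) (hgm t))
      (by push_cast at hp₁; omega) (by push_cast at hq₁; omega) hy)
    (fun t p₀ q₀ y _ hy hlt ↦ corrAction_eq_zero_of_hodgeType_lt hY (hX.pow (e t)) (hab t)
      (isOfHodgeType_of_mem_motivatedClasses (IsSmoothProjective.tensor_holds hY (hX.pow (e t))) (hgm t))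
      (by push_cast at hlt; omega) hy)
    hc hpp (Submodule.span_le.2 (fun t ht ↦ Submodule.mem_iSup_of_mem (⟨t, ht⟩ : T) (hgt ⟨t, ht⟩)) hcT)
  -- each summand is motivated: `a t` is, and `[g t]_*` preserves motivated classes (`g t` motivated)
  rw [hsum]
  refine Submodule.sum_mem _ fun t _ ↦ ?_
  rw [corrAction_eq_corrClassAction complexOrientationFamily hY (hX.pow (e t)) (hab t) hk]
  exact corrClassAction_mem_motivatedClasses_of_motivated hY (hX.pow (e t)) _ _
    (hasPoincareDuality_complexOrientationFamily (IsSmoothProjective.tensor_holds hY (hX.pow (e t))))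
    (hasPoincareDuality_complexOrientationFamily hY) (hab t) hk (hgm t) (hAC (e t) (d t) (a t) (ha t).1 (ha t).2)

/-- **Strong domination is weak domination** (bookkeeping): if `Y` is dominated by the powers of `X` through ALGEBRAIC
correspondences (`HodgeTheory.IsDominatedByPowers`), the spanning hypothesis of §2 holds in every degree `2p`, since the
rational algebraic correspondence classes of the tree's `CorCM.Stage4.span_rationalAlgebraicCorrRanges_eq_top` are
motivated (André §2.1 «il est clair», the tree's `algebraicClasses_le_motivatedClasses_of_nonempty_hardLefschetzNFold_self`).
[cite: Arapura2006, §1 Lemma 1.1] [cite: Andre1996Motifs, §2.1 (p. 14)] -/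
theorem span_motivatedCorrRanges_eq_top_of_isDominatedByPowers (hX : IsSmoothProjective dX X)
    (hY : IsSmoothProjective dY Y) (hdom : IsDominatedByPowers dY Y dX X) (p : ℕ) :
    Submodule.span ℂ
        {c : complexBetti Y (2 * p) |
          ∃ (e cd d : ℕ) (hab : 2 * d + 2 * cd = 2 * p + 2 * (e * dX))
            (u : complexBetti (Y ⊗ X.pow e) (2 * cd)),
            u ∈ motivatedClasses (dY + e * dX) (Y ⊗ X.pow e) cd ∧
              c ∈ LinearMap.range (corrAction complexOrientationFamily hY (hX.pow e) hab u)} = ⊤ := by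
  refine eq_top_iff.2
    ((CorCM.Stage4.span_rationalAlgebraicCorrRanges_eq_top hX hY hdom p).symm.le.trans (Submodule.span_mono ?_))
  rintro c ⟨e, cd, d, hab, γ, -, hγa, hc⟩
  exact ⟨e, cd, d, hab, γ,
    algebraicClasses_le_motivatedClasses_of_nonempty_hardLefschetzNFold_self
      (IsSmoothProjective.tensor_holds hY (hX.pow e)) (nonempty_hardLefschetzNFold_holds _ _) cd hγa, hc⟩

/-! ## §3 Cor. 4.4 modulo c2: weakly motivated by an abelian variety ⟹ `AC` -/

/-- **ARAPURA 2006 COR. 4.4, MODULO c2 — «If `X` is weakly motivated by an Abelian variety, then `AC` holds for `X`»,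
in the cohomological rendering of Lemma 1.1.** For `Y` smooth projective of dimension `dY` and a complex abelian variety
`A` such that `H²ᵖ(Y(ℂ); ℂ)` is the span of the images of the actions of MOTIVATED classes on the products `Y ⊗ A.Xᵉ`,
every rational `(p,p)`-class on `Y` is motivated — granted André's Thm. 0.6.2 (named fact c2, displayed hypothesis `hAM`,
NOT asserted), which gives `AC` on the powers of `A` (companion's `hodgeClasses_pow_motivated_of_andre1996`).
[cite: Arapura2006, §4 Cor. 4.4 and §1 Lemma 1.1] [cite: Andre1996Motifs, Thm. 0.6.2 (p. 9)] -/
theorem hodgeClasses_motivated_of_motivatedDomination_abelianVariety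
    (hAM : Andre1996_hodgeClasses_abelianVariety_motivated) (A : AbelianVariety ℂ) (hY : IsSmoothProjective dY Y)
    (p : ℕ)
    (hdom : Submodule.span ℂ
        {c : complexBetti Y (2 * p) |
          ∃ (e cd d : ℕ) (hab : 2 * d + 2 * cd = 2 * p + 2 * (e * A.dim))
            (u : complexBetti (Y ⊗ A.X.pow e) (2 * cd)),
            u ∈ motivatedClasses (dY + e * A.dim) (Y ⊗ A.X.pow e) cd ∧
              c ∈ LinearMap.range
                (corrAction complexOrientationFamily hY ((AbelianVariety.isSmoothProjective_holds (A := A)).pow e)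
                  hab u)} = ⊤)
    {c : complexBetti Y (2 * p)} (hc : IsRationalClass c) (hpp : IsOfHodgeType dY Y (2 * p) p p c) :
    c ∈ motivatedClasses dY Y p :=
  hodgeClasses_motivated_of_motivatedDomination AbelianVariety.isSmoothProjective_holds hY p hdom
    (hodgeClasses_pow_motivated_of_andre1996 hAM A) hc hpp

end Summit.HodgeConjecture.HodgeConjecture.Theorems

end
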